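import Literature.Analysis.FluidPDE.FiniteFourierModeEulerPlanarMech
import Literature.Analysis.FluidPDE.FiniteFourierModeEulerPlanarOmega

/-!
# Kishimoto–Yoneda §3 (planar case), Lemma 3.3: the transport has no finitely supported eigenvector

Support file for `FiniteFourierModeEuler` (N. Kishimoto, T. Yoneda, J. Math. Fluid Mech. 24
(2022) 74 = arXiv:2110.08039), §3 Lemma 3.3, in the following time-free form which is what the
stationarity of `u^⊥` requires: the vertical transport operator `A` (`convOp`, built from the
stationary horizontal flow on the circle polygon) has NO finitely supported eigenvector with a
non-zero eigenvalue (`no_eigenvector`). The proof is the paper's: by Lemma 3.2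
(`FiniteFourierModeEulerPlanarMech`) the top layer of the support of an eigenvector `φ` is the
lattice `{ñ_{j,k}}` at an integer level `q` with the binomial recursion; subtracting
`β ω^q` (`Omega q`, same recursion, `A Ω_q = 0`) kills the top layer; the remainder `ζ` has gauge
`< q`, hence `≤ q - 1` (Lemma 3.2 again: a level in `(q-1, q)` would have to be an integer); and
comparing the coefficient of `A ζ = θ φ` at `q n₀` ("the only possible pair … is `(n₀, (q-1)n₀)`",
which does not interact) gives `θ φ(q n₀) = 0`, a contradiction.

## References

* [KishimotoYoneda2022] N. Kishimoto, T. Yoneda, J. Math. Fluid Mech. 24 (2022) 74 =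
  arXiv:2110.08039, §3 Lemmas 3.2, 3.3 and their proofs.
-/

noncomputable section

open Matrix Finset Complex

namespace Literature.Analysis.FluidPDE

namespace KY

open scoped Classical

namespace PolyCfg

variable {T : Finset (Fin 3 → ℝ)} {e : Fin 3 → ℝ} (P : PolyCfg T e)

/-- The maximal gauge over the support of a finitely supported function. [folklore] -/
theorem exists_max_gauge {φ : (Fin 3 → ℝ) → ℂ} {F : Finset (Fin 3 → ℝ)} (hF : ∀ n, φ n ≠ 0 → n ∈ F)
    (hne : ∃ n, φ n ≠ 0) :
    ∃ qs : ℝ, (∀ n, φ n ≠ 0 → P.Nf n ≤ qs) ∧ ∃ n, φ n ≠ 0 ∧ P.Nf n = qs := by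
  set G := F.filter fun n => φ n ≠ 0 with hG
  have hGne : G.Nonempty := by obtain ⟨n, hn⟩ := hne; exact ⟨n, Finset.mem_filter.2 ⟨hF n hn, hn⟩⟩
  obtain ⟨n₀, hn₀, hmax⟩ := G.exists_max_image (fun n => P.Nf n) hGne
  refine ⟨P.Nf n₀, fun n hn => hmax n (Finset.mem_filter.2 ⟨hF n hn, hn⟩), n₀, (Finset.mem_filter.1 hn₀).2, rfl⟩

variable {α : (Fin 3 → ℝ) → ℂ} (hα : ∀ n ∈ T, α n ≠ 0)
  (hside : ∀ j, ∀ n ∈ T, P.fE j n = 1 → n = P.V j ∨ n = P.V (j + 1))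
  (hvert : ∀ s ∈ T, s ≠ P.V 0 → P.gV 0 s < 1)
include hα hside hvert

/-- **Lemma 3.3 (time-free form): no finitely supported eigenvector of the vertical transport
with non-zero eigenvalue.** [cite: KishimotoYoneda2022, §3 Lemma 3.3 (proof: "`β'_q(t) = 0`")] -/
theorem no_eigenvector {φ : (Fin 3 → ℝ) → ℂ} {F : Finset (Fin 3 → ℝ)} (hF : ∀ n, φ n ≠ 0 → n ∈ F)
    (hF0 : (0 : Fin 3 → ℝ) ∉ F) (hplane : ∀ n, φ n ≠ 0 → e ⬝ᵥ n = 0) {θ : ℂ} (hθ : θ ≠ 0)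
    (heig : ∀ n, convOp T e α φ n = θ * φ n) : ∀ n, φ n = 0 := by
  by_contra hsupp
  push Not at hsupp
  -- the top level `q*` of the support and the mechanism for `φ`
  obtain ⟨qs, htop, hatt⟩ := P.exists_max_gauge hF hsupp
  have hqs : 0 < qs := by
    obtain ⟨n, hn, hN⟩ := hatt
    rw [← hN]
    exact P.Nf_pos (hplane n hn) (fun h => hF0 (h ▸ hF n hn))
  have hHφ : ∀ r : ℝ, (∀ n, φ n ≠ 0 → P.Nf n ≤ r) → ∀ n, P.Nf n = r + 1 → convOp T e α φ n = 0 := by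
    intro r hr n hN
    rw [heig]
    by_cases h : φ n = 0
    · rw [h, mul_zero]
    · have := hr n h; linarith
  have Mφ : MechCfg P α φ qs := ⟨hα, hside, hqs, htop, hHφ qs htop⟩
  obtain ⟨q, hq0, hq, j₁, hj₁⟩ := Mφ.exists_nat hatt hplane
  subst hq
  -- `Ω_q` and its mechanism
  set Ω := Omega T α q with hΩ
  have hΩA : ∀ n, convOp T e α Ω n = 0 := convOp_Omega T e α q
  have hΩtop : ∀ n, Ω n ≠ 0 → P.Nf n ≤ q := fun n hn => P.Nf_le_of_Omega_ne_zero α hn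
  have hΩv : Ω ((q : ℝ) • P.V 0) = (Complex.I * α (P.V 0)) ^ q := P.Omega_vertex α hvert q
  have hΩv0 : Ω ((q : ℝ) • P.V 0) ≠ 0 := by
    rw [hΩv]; exact pow_ne_zero _ (mul_ne_zero Complex.I_ne_zero (hα _ (P.V_mem 0)))
  have hq0' : (0 : ℝ) < q := by exact_mod_cast hq0
  have MΩ : MechCfg P α Ω q := ⟨hα, hside, hq0', hΩtop, fun n _ => hΩA n⟩
  have hΩplane : ∀ n, Ω n ≠ 0 → e ⬝ᵥ n = 0 := fun n hn => P.Omega_plane α hn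
  -- all lattice points are in the support of `φ`
  have hφlat : ∀ j k, k ≤ q → φ (P.lat q j k) ≠ 0 := Mφ.lat_ne_zero hj₁
  -- the difference `ζ = φ - β Ω`
  set β : ℂ := φ ((q : ℝ) • P.V 0) / Ω ((q : ℝ) • P.V 0) with hβ
  set ζ : (Fin 3 → ℝ) → ℂ := fun n => φ n - β * Ω n with hζ
  have hζA : ∀ n, convOp T e α ζ n = θ * ζ n + θ * β * Ω n := by
    intro n
    have : ζ = φ - β • Ω := by funext n; simp [hζ]
    rw [this, convOp_sub, convOp_smul, hΩA, heig, mul_zero, sub_zero]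
    simp only [Pi.sub_apply, Pi.smul_apply, smul_eq_mul]; ring
  -- (Z1) `ζ` vanishes on the lattice
  have hZ1 : ∀ j k, k ≤ q → ζ (P.lat q j k) = 0 := by
    intro j
    induction j with
    | zero =>
      intro k hk
      induction k with
      | zero =>
        simp only [hζ, MechCfg.lat_zero, hβ]
        rw [div_mul_cancel₀ _ hΩv0, sub_self]
      | succ k ih =>
        have hk' : k < q := hk
        have h1 := Mφ.lat_rec (j := 0) hk'
        have h2 := MΩ.lat_rec (j := 0) hk'
        have h3 : (((k : ℝ) + 1 : ℝ) : ℂ) * α (P.V 0) * ζ (P.lat q 0 (k + 1))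
            = (((q : ℝ) - k : ℝ) : ℂ) * α (P.V (0 + 1)) * ζ (P.lat q 0 k) := by
          simp only [hζ]; linear_combination h1 - β * h2
        rw [ih hk'.le, mul_zero] at h3
        have hc : (((k : ℝ) + 1 : ℝ) : ℂ) * α (P.V 0) ≠ 0 :=
          mul_ne_zero (by exact_mod_cast (by positivity : (k : ℝ) + 1 ≠ 0)) (hα _ (P.V_mem 0))
        exact (mul_eq_zero.1 h3).resolve_left hc
    | succ j ihj =>
      intro k hk
      induction k with
      | zero =>
        have := ihj q le_rfl
        rwa [MechCfg.lat_self, ← MechCfg.lat_zero (P := P) (q := q) (j + 1)] at this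
      | succ k ih =>
        have hk' : k < q := hk
        have h1 := Mφ.lat_rec (j := j + 1) hk'
        have h2 := MΩ.lat_rec (j := j + 1) hk'
        have h3 : (((k : ℝ) + 1 : ℝ) : ℂ) * α (P.V (j + 1)) * ζ (P.lat q (j + 1) (k + 1))
            = (((q : ℝ) - k : ℝ) : ℂ) * α (P.V (j + 1 + 1)) * ζ (P.lat q (j + 1) k) := by
          simp only [hζ]; linear_combination h1 - β * h2
        rw [ih hk'.le, mul_zero] at h3
        have hc : (((k : ℝ) + 1 : ℝ) : ℂ) * α (P.V (j + 1)) ≠ 0 :=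
          mul_ne_zero (by exact_mod_cast (by positivity : (k : ℝ) + 1 ≠ 0)) (hα _ (P.V_mem (j + 1)))
        exact (mul_eq_zero.1 h3).resolve_left hc
  -- (Z2) the support of `ζ` has gauge `< q`
  have hζplane : ∀ n, ζ n ≠ 0 → e ⬝ᵥ n = 0 := by
    intro n hn
    by_cases h : φ n = 0
    · have : Ω n ≠ 0 := fun h0 => hn (by simp [hζ, h, h0])
      exact hΩplane n this
    · exact hplane n h
  have hZ2 : ∀ n, ζ n ≠ 0 → P.Nf n < q := by
    intro n hn
    by_cases h : φ n = 0
    · have hΩn : Ω n ≠ 0 := fun h0 => hn (by simp [hζ, h, h0])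
      rcases (hΩtop n hΩn).lt_or_eq with hlt | heq
      · exact hlt
      · obtain ⟨j, k, hk, rfl⟩ := MΩ.top_subset_lat hΩplane hΩn heq
        exact absurd (hZ1 j k hk) hn
    · rcases (htop n h).lt_or_eq with hlt | heq
      · exact hlt
      · obtain ⟨j, k, hk, rfl⟩ := Mφ.top_subset_lat hplane h heq
        exact absurd (hZ1 j k hk) hn
  -- the support of `ζ` is finite
  obtain ⟨G, hG⟩ := Omega_support T α q
  have hζF : ∀ n, ζ n ≠ 0 → n ∈ F ∪ G := by
    intro n hn
    by_cases h : φ n = 0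
    · have : Ω n ≠ 0 := fun h0 => hn (by simp [hζ, h, h0])
      exact Finset.mem_union_right _ (hG n this)
    · exact Finset.mem_union_left _ (hF n h)
  -- (Z3) in fact gauge `≤ q - 1`
  have hZ3 : ∀ n, ζ n ≠ 0 → P.Nf n ≤ q - 1 := by
    by_cases hζne : ∃ n, ζ n ≠ 0
    · obtain ⟨qt, hqt, hattζ⟩ := P.exists_max_gauge hζF hζne
      obtain ⟨n₁, hn₁, hN₁⟩ := hattζ
      have hqtq : qt < q := by rw [← hN₁]; exact hZ2 n₁ hn₁
      by_cases hgt : (q : ℝ) - 1 < qt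
      · exfalso
        -- the mechanism for `ζ` at level `qt`
        have hHζ : ∀ n, P.Nf n = qt + 1 → convOp T e α ζ n = 0 := by
          intro n hN
          rw [hζA]
          have hz : ζ n = 0 := by
            by_contra h; have := hqt n h; linarith
          have hw : Ω n = 0 := by
            by_contra h; have := hΩtop n h; linarith
          rw [hz, hw, mul_zero, mul_zero, add_zero]
        have hq1 : (1 : ℝ) ≤ q := by exact_mod_cast hq0
        have Mζ : MechCfg P α ζ qt := ⟨hα, hside, by linarith, hqt, hHζ⟩
        obtain ⟨q', -, hq', -⟩ := Mζ.exists_nat ⟨n₁, hn₁, hN₁⟩ hζplane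
        rw [← hq'] at hqtq hgt
        have h1 : q' < q := by exact_mod_cast hqtq
        have h2 : (q : ℝ) < q' + 1 := by linarith
        have h3 : q < q' + 1 := by exact_mod_cast h2
        omega
      · intro n hn
        rw [not_lt] at hgt
        exact (hqt n hn).trans hgt
    · intro n hn; exact absurd ⟨n, hn⟩ hζne
  -- the coefficient of `A ζ` at `q V₀`
  set x₀ := (q : ℝ) • P.V 0 with hx₀
  have hL : convOp T e α ζ x₀ = 0 := by
    unfold convOp
    rw [mul_eq_zero]; right
    apply Finset.sum_eq_zero
    intro m hm
    by_cases hz : ζ (x₀ - m) = 0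
    · rw [hz, mul_zero]
    · have hle := hZ3 _ hz
      have hg : P.gV 0 (x₀ - m) ≤ P.Nf (x₀ - m) := by
        unfold gV
        have := P.fE_le_Nf (0 + P.m) (x₀ - m)
        have := P.fE_le_Nf 0 (x₀ - m)
        linarith
      rw [P.gV_sub, hx₀, P.gV_smul, P.gV_V_self] at hg
      have hgm : 1 ≤ P.gV 0 m := by linarith
      have hmV : m = P.V 0 := by
        by_contra hne; exact absurd (hvert m hm hne) (not_lt.2 hgm)
      rw [hmV, pc_sub_right, pc_smul_right, pc_self, mul_zero, sub_zero]
      simp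
  have hR : convOp T e α ζ x₀ = θ * φ x₀ := by
    rw [hζA, show ζ x₀ = 0 from by simpa [MechCfg.lat_zero] using hZ1 0 0 (Nat.zero_le _), mul_zero, zero_add,
      hβ, mul_assoc, div_mul_cancel₀ _ hΩv0]
  rw [hL] at hR
  have hφx₀ : φ x₀ ≠ 0 := by have := hφlat 0 0 (Nat.zero_le _); rwa [MechCfg.lat_zero] at this
  exact absurd hR.symm (mul_ne_zero hθ hφx₀)

end PolyCfg

end KY

end Literature.Analysis.FluidPDE
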